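import Summits.ABC.StewartYu.PadicG3HalfStep
import Summits.ABC.StewartYu.PadicTwistExistsAnyOrder
import HarnessLib

/-!
# Cell abc-stewartyu, crux `Y07Odd` (stmt-ABC-19658), line `gen3-slab-odd`: the Gen-3 datum BUILT FROM THE FRAME'S DATA (Teichmüller twist for
# every odd `p`), and the EXPONENT-CLASS DATA of the half-step (`ζ`, `r`, `ξ`, `ι`; `cls v = 1 ⇒ (p−1) ∣ Σ r_j v_j`)

`Summits/ABC/StewartYu/PadicG3OfData.lean` — cell `abc-stewartyu` (design HOME/p2/HALFSTEP-ODD.md, SETUP3-SPEC §H; seat p2-g4, F-odd lead).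
One definition (`G3Setup.ofData`) and theorems; no named fact.  Reuses M2's `TwistExistsAnyOrder` (primitive `(p−1)`-th root `ζ ∈ ℚ_p` with
`ζ^{(p−1)/2} = −1`, the twists `η_j = ζ^{r_j}` making `α_j η_j` principal units, the square root `ξ` of `ζ` in `ℂ_p`).

* `ofData` — from `3 ≤ p`, generators `α_j ≠ 0` of `p`-adic valuation `0`, coefficients `b` and a pivot `j₀` of minimal order: a `G3Setup p`
  with `η_j = ζ^{r_j}`; `ofData_α`, `ofData_b`, `ofData_n` (definitional readback);
* `sum_mul_dvd_of_cls_eq_one` — on such a datum, `cls v = 1 ⇒ ((p−1 : ℕ) : ℤ) ∣ Σ_j r_j v_j` (the exponent class of the half-step is EVEN);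
* `exists_halfStep_rootData` — the `ℂ_p` data `(ξ, ι, ŝ)` of `PadicG3HalfSplit`/`HalfSeparation` exist for it.

WHAT THIS IS NOT: no levels, no record; no crux moves.

References: K. Yu, Acta Arith. 89 (1999) §1 (the twist); Compositio 74 (1990) (2.92); cell files `PadicTwistExistsAnyOrder`, `PadicTwistPMRoots`.
-/

noncomputable section

open NormedSpace Finset
open Literature.NumberTheory.Transcendental

namespace Summit.ABC.StewartYu

namespace G3Setup

variable {p : ℕ} [Fact p.Prime]

/-! ### The datum from the frame's data -/

/-- **The Gen-3 datum of the frame's data** `(α, b, j₀)` at an odd prime, twisted by `η_j = ζ^{r_j}` (Teichmüller).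
[cite: Yu1999, §1; shape only] -/
def ofData (hp3 : 3 ≤ p) {n : ℕ} (α : Fin n → ℚ) (hα : ∀ j, α j ≠ 0) (hvα : ∀ j, padicValRat p (α j) = 0)
    (b : Fin n → ℤ) (j₀ : Fin n) (hb : b j₀ ≠ 0) (hbmin : ∀ j, b j ≠ 0 → padicValInt p (b j₀) ≤ padicValInt p (b j)) :
    G3Setup p :=
  let ζ := Classical.choose (TwistExistsAnyOrder.exists_primitiveRoot (p := p) hp3)
  let hζ := Classical.choose_spec (TwistExistsAnyOrder.exists_primitiveRoot (p := p) hp3)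
  let r := Classical.choose (TwistExistsAnyOrder.twist_exists_family_anyOrder hζ.2.2 hζ.1 α hα hvα)
  let hr := Classical.choose_spec (TwistExistsAnyOrder.twist_exists_family_anyOrder hζ.2.2 hζ.1 α hα hvα)
  { hp3 := hp3, n := n, α := α, α_ne := hα, b := b, j₀ := j₀, bj₀_ne := hb, hbmin := hbmin,
    η := fun j => ζ ^ r j,
    hη := fun j => by rw [← pow_mul, mul_comm, pow_mul, hζ.1.pow_eq_one, one_pow],
    hprin := fun j => (hr j).2 }

section readback

variable (hp3 : 3 ≤ p) {n : ℕ} (α : Fin n → ℚ) (hα : ∀ j, α j ≠ 0) (hvα : ∀ j, padicValRat p (α j) = 0)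
    (b : Fin n → ℤ) (j₀ : Fin n) (hb : b j₀ ≠ 0) (hbmin : ∀ j, b j ≠ 0 → padicValInt p (b j₀) ≤ padicValInt p (b j))

/-- `(ofData …).n = n`. [folklore] -/
theorem ofData_n : (ofData hp3 α hα hvα b j₀ hb hbmin).n = n := rfl

/-- `(ofData …).α = α`. [folklore] -/
theorem ofData_α : (ofData hp3 α hα hvα b j₀ hb hbmin).α = α := rfl

/-- `(ofData …).b = b`. [folklore] -/
theorem ofData_b : (ofData hp3 α hα hvα b j₀ hb hbmin).b = b := rfl

/-- `(ofData …).j₀ = j₀`. [folklore] -/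
theorem ofData_j₀ : (ofData hp3 α hα hvα b j₀ hb hbmin).j₀ = j₀ := rfl

/-- **The twist exponents**: there are `ζ` (primitive of order `p − 1`, `ζ^{(p−1)/2} = −1`, `‖ζ‖ = 1`) and `r` with `η_j = ζ^{r_j}`.
[cite: Yu1999, §1; shape only] -/
theorem ofData_exists_zeta :
    ∃ (ζ : ℚ_[p]) (r : Fin n → ℕ), IsPrimitiveRoot ζ (p - 1) ∧ ζ ^ ((p - 1) / 2) = -1 ∧ ‖ζ‖ = 1 ∧
      ∀ j, (ofData hp3 α hα hvα b j₀ hb hbmin).η j = ζ ^ r j :=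
  ⟨_, _, (Classical.choose_spec (TwistExistsAnyOrder.exists_primitiveRoot (p := p) hp3)).1,
    (Classical.choose_spec (TwistExistsAnyOrder.exists_primitiveRoot (p := p) hp3)).2.1,
    (Classical.choose_spec (TwistExistsAnyOrder.exists_primitiveRoot (p := p) hp3)).2.2, fun _ => rfl⟩

end readback

/-! ### The exponent class of the half-step is even -/

variable (S : G3Setup p)

/-- **`cls v = 1 ⇒ (p − 1) ∣ Σ_j r_j v_j`** when `η_j = ζ^{r_j}` for a primitive `(p−1)`-th root `ζ`. [folklore] -/
theorem sum_mul_dvd_of_cls_eq_one {ζ : ℚ_[p]} (hζ : IsPrimitiveRoot ζ (p - 1)) (r : Fin S.n → ℕ) (hη : ∀ j, S.η j = ζ ^ r j)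
    (v : Fin S.n → ℤ) (hcls : S.cls v = 1) : ((p - 1 : ℕ) : ℤ) ∣ ∑ j, (r j : ℤ) * v j := by
  have hζ0 : ζ ≠ 0 := hζ.ne_zero (by have := S.hp3; omega)
  have hzs : ∀ (t : Finset (Fin S.n)), ζ ^ (∑ j ∈ t, (r j : ℤ) * v j) = ∏ j ∈ t, ζ ^ ((r j : ℤ) * v j) := by
    intro t
    induction t using Finset.induction_on with
    | empty => simp
    | insert j t hj ih => rw [sum_insert hj, prod_insert hj, zpow_add₀ hζ0, ih]
  have hprod : S.cls v = ζ ^ (∑ j, (r j : ℤ) * v j) := by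
    unfold cls
    rw [hzs]
    refine prod_congr rfl fun j _ => ?_
    rw [hη j, ← zpow_natCast, ← zpow_mul]
  rw [hprod] at hcls
  exact (hζ.zpow_eq_one_iff_dvd _).mp hcls

/-- **The root exponents of the half-step lie in ONE, EVEN exponent class.**  With `η_j = ζ^{r_j}` (`ζ` primitive of order `p − 1 = 2M`) and
`cls vᵢ = 1` on `B` (box `|vᵢⱼ| ≤ L_j`), the natural root exponents `eᵢ = rootExp L vᵢ s` satisfy `Σ_j r_j eᵢⱼ = c₀ + kᵢ·M` with
`kᵢ = 2(qᵢ s + a)`, where `(p−1)·qᵢ = Σ_j r_j vᵢⱼ` and `a, c₀` do not depend on `i` (so the PM sign `(−1)^{kᵢ/2} = (−1)^a·(−1)^{qᵢ s}` is a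
global sign times a per-index sign). [folklore] -/
theorem exists_expClass {ζ : ℚ_[p]} (hζ : IsPrimitiveRoot ζ (p - 1)) (r : Fin S.n → ℕ) (hη : ∀ j, S.η j = ζ ^ r j)
    {ι : Type*} (v : ι → Fin S.n → ℤ) (B : Finset ι) (hcls : ∀ i ∈ B, S.cls (v i) = 1)
    {L : Fin S.n → ℕ} (hL : ∀ i ∈ B, ∀ j, |v i j| ≤ (L j : ℤ)) (s : ℤ) :
    ∃ (c₀ a : ℕ) (k : ι → ℕ) (q : ι → ℤ),
      (∀ i ∈ B, ∑ j, r j * S.rootExp L (v i) s j = c₀ + k i * ((p - 1) / 2)) ∧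
      (∀ i ∈ B, ((p - 1 : ℕ) : ℤ) * q i = ∑ j, (r j : ℤ) * v i j) ∧
      (∀ i ∈ B, (k i : ℤ) = 2 * (q i * s + a)) := by
  classical
  have hp1 : 2 ≤ p - 1 := by have := S.hp3; omega
  have hev : Even (p - 1) := by
    have hp : p.Prime := Fact.out
    have hodd : Odd p := hp.odd_of_ne_two (by have := S.hp3; omega)
    obtain ⟨m, hm⟩ := hodd
    exact ⟨m, by omega⟩
  have h2M : 2 * ((p - 1) / 2) = p - 1 := Nat.two_mul_div_two_of_even hev
  set M : ℕ := (p - 1) / 2 with hM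
  set P : ℤ := ((p - 1 : ℕ) : ℤ) with hPdef
  have hP0 : 0 < P := by rw [hPdef]; exact_mod_cast (show 0 < p - 1 by omega)
  have hPM : P = 2 * (M : ℤ) := by rw [hPdef, hM]; exact_mod_cast h2M.symm
  set A : ℤ := 2 * ∑ j, (r j : ℤ) * (L j * |s|) with hA
  have hA0 : 0 ≤ A := by
    have : 0 ≤ ∑ j, (r j : ℤ) * (L j * |s|) := sum_nonneg fun j _ => by positivity
    rw [hA]; linarith
  -- `q i` from the twist class, and the exponent sums
  have hsum : ∀ i ∈ B, ∃ q : ℤ, P * q = ∑ j, (r j : ℤ) * v i j ∧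
      ((∑ j, r j * S.rootExp L (v i) s j : ℕ) : ℤ) = P * (q * s) + A := by
    intro i hi
    obtain ⟨q, hq⟩ := S.sum_mul_dvd_of_cls_eq_one hζ r hη (v i) (hcls i hi)
    refine ⟨q, hq.symm, ?_⟩
    push_cast
    have he : ∀ j, ((S.rootExp L (v i) s j : ℕ) : ℤ) = v i j * s + 2 * (L j * |s|) := fun j => S.rootExp_cast (hL i hi) s j
    simp_rw [he]
    have : ∑ j, (r j : ℤ) * (v i j * s + 2 * (L j * |s|)) = (∑ j, (r j : ℤ) * v i j) * s + 2 * ∑ j, (r j : ℤ) * (L j * |s|) := by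
      rw [sum_mul, mul_sum, ← sum_add_distrib]
      exact sum_congr rfl fun j _ => by ring
    rw [this, hq, hA, hPdef]
    ring
  choose! q hq he using hsum
  -- `a := A / P`, `c₀ := A % P`
  have hmod0 : 0 ≤ A % P := Int.emod_nonneg _ hP0.ne'
  have hdiv0 : 0 ≤ A / P := Int.ediv_nonneg hA0 hP0.le
  have hAP : A = P * (A / P) + A % P := (Int.mul_ediv_add_emod A P).symm
  refine ⟨(A % P).toNat, (A / P).toNat, fun i => (2 * (q i * s + (A / P))).toNat, q, ?_, fun i hi => hq i hi, ?_⟩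
  · intro i hi
    -- in ℤ: `Σ r e = A % P + 2 (q s + A/P) · M`
    have hk0 : 0 ≤ 2 * (q i * s + A / P) := by
      -- `P (q s) + A = P (q s + A/P) + A % P ≥ 0` and `A % P < P`
      have hnn : 0 ≤ P * (q i * s) + A := by rw [← he i hi]; positivity
      have hlt : A % P < P := Int.emod_lt_of_pos _ hP0
      have h1 : P * (q i * s + A / P) + A % P = P * (q i * s) + A := by rw [mul_add, add_assoc, ← hAP]
      have h2 : -P < P * (q i * s + A / P) := by linarith
      have h3 : -1 < q i * s + A / P := by
        by_contra hc
        push Not at hc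
        have : P * (q i * s + A / P) ≤ P * (-1) := mul_le_mul_of_nonneg_left hc hP0.le
        linarith
      linarith
    zify
    rw [Int.toNat_of_nonneg hmod0, Int.toNat_of_nonneg hk0]
    have he' := he i hi
    push_cast at he'
    rw [he']
    have : P * (q i * s) + A = A % P + 2 * (q i * s + A / P) * (M : ℤ) := by
      rw [show 2 * (q i * s + A / P) * (M : ℤ) = (2 * (M : ℤ)) * (q i * s + A / P) by ring, ← hPM, mul_add]
      linarith [hAP]
    exact this
  · intro i hi
    have hk0 : 0 ≤ 2 * (q i * s + A / P) := by
      have hnn : 0 ≤ P * (q i * s) + A := by rw [← he i hi]; positivity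
      have hlt : A % P < P := Int.emod_lt_of_pos _ hP0
      have h1 : P * (q i * s + A / P) + A % P = P * (q i * s) + A := by rw [mul_add, add_assoc, ← hAP]
      have h3 : -1 < q i * s + A / P := by
        by_contra hc
        push Not at hc
        have : P * (q i * s + A / P) ≤ P * (-1) := mul_le_mul_of_nonneg_left hc hP0.le
        linarith
      linarith
    rw [Int.toNat_of_nonneg hk0, Int.toNat_of_nonneg hdiv0]

/-- **The `ℂ_p` root data of the half-step exist**: `ξ, ι` with `ξ^{(p−1)/2} = ι`, `ι² = −1`, `‖ξ‖ = 1`, and `ŝ_j` with `sq_j = ŝ_j ξ^{r_j}`,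
`ŝ_j² = α_j`, `‖ŝ_j‖ ≤ 1`. [folklore] -/
theorem exists_halfStep_rootData {ζ : ℚ_[p]} (hζM : ζ ^ ((p - 1) / 2) = -1) (hζ1 : ‖ζ‖ = 1) (r : Fin S.n → ℕ)
    (hη : ∀ j, S.η j = ζ ^ r j) :
    ∃ (ξ ιC : ℂ_[p]) (ŝ : Fin S.n → ℂ_[p]), ξ ^ ((p - 1) / 2) = ιC ∧ ιC ^ 2 = -1 ∧ ‖ξ‖ = 1 ∧
      (∀ j, algebraMap ℚ_[p] ℂ_[p] (S.sq j) = ŝ j * ξ ^ r j) ∧ (∀ j, ŝ j * ŝ j = (S.α j : ℂ_[p])) ∧ (∀ j, ‖ŝ j‖ ≤ 1) := by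
  obtain ⟨ξ, ιC, hξ2, hξM, hι2, hξ⟩ := TwistExistsAnyOrder.exists_sqrt_root_padicComplex hζ1 hζM
  obtain ⟨ŝ, hσ, hŝ, hŝ1⟩ := S.exists_root_data r hη hξ2 hξ
  exact ⟨ξ, ιC, ŝ, hξM, hι2, hξ, hσ, hŝ, hŝ1⟩

end G3Setup

end Summit.ABC.StewartYu

end
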